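import Summits.Ventures.Crystal3D.Theorems.StickyWulffConstantTextureLiminfBarlowFreeCertificate
import HarnessLib

/-!
# Line TexShadow for crux TextureLiminfV5 — COVER CLAUSE DEFINITIONS (T0)

HONEST FRAMING. Venture `Summits/Ventures/Crystal3D` (cell `crystal3d-full`), route `route-Ventures-StickyWulffConstant`,
helper `--supports` crux `TextureLiminfV5` (stmt-Ventures-23912). Finding (F9): `BarlowFreeCertificate` as typed and
proved (`stub_barlowFreeCertificate` via `tent_bilayer_certificate`) picks a generic level INDEPENDENTLY per bilayer;
layer-plane facets are then NOT a.e. covered across consecutive slabs, so there are unpriced horizontal fins. This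
file defines the COVER CLAUSE that holds with ONE COMMON LEVEL t across all bilayers.

* `layerPlane L s i` — the close-packed layer plane at height `i · hB` in the frame `(L, s)`;
* `LayerPlaneCover` — every piece's layer-plane facets are a.e. covered by the closures of other pieces;
* `BarlowFreeCertificateCover` — `BarlowFreeCertificate` with the additional `LayerPlaneCover` clause.

The proof `barlowFreeCertificateCover_holds : BarlowFreeCertificateCover` requires refactoring `tent_bilayer_certificate`
to a level-parametrized form (cost functions F_i and bad sets summed/unioned, then ONE global t picked by
`exists_mem_Ioo_le_of_lintegral_le`) and is in a companion file.

WHAT THIS IS NOT: any statement about `stub_textureBuild`; F-C1 not moved.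
-/

noncomputable section

open scoped BigOperators InnerProductSpace ENNReal
open MeasureTheory Filter

namespace Summit.Ventures.Crystal3D.Cruxes.TextureLiminf.TexShadow

open Summit.Ventures.Crystal3D Summit.Ventures.Crystal3D.TentCertificate
open Literature.MathematicalPhysics.StatisticalMechanics (fccStacking barlowStacking IsHaggSeq
  fieldDivergence HasFinitePerimeter)

/-! ## Layer planes -/

/-- The close-packed LAYER PLANE at index `i` of the frame `(L, s)`: the affine plane at height `i · hB`
(`hB = √(2/3)` is the layer spacing of the Barlow reference frame). -/
def layerPlane (L : E3 ≃ₗᵢ[ℝ] E3) (s : E3) (i : ℤ) : Set E3 :=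
  (fun r => L r + s) '' {r : E3 | r 2 = (i : ℝ) * hB}

/-- Layer plane as a level set of a linear functional. -/
theorem layerPlane_eq_levelSet (L : E3 ≃ₗᵢ[ℝ] E3) (s : E3) (i : ℤ) :
    layerPlane L s i = {y : E3 | ⟪L (EuclideanSpace.single 2 1), y - s⟫_ℝ = (i : ℝ) * hB} := by
  ext y
  simp only [layerPlane, Set.mem_image, Set.mem_setOf_eq]
  constructor
  · rintro ⟨r, hr, rfl⟩
    simp only [add_sub_cancel_right]
    rw [← hr, show r 2 = ⟪EuclideanSpace.single 2 1, r⟫_ℝ by simp [EuclideanSpace.inner_single_left]]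
    simp [LinearIsometryEquiv.inner_map_map]
  · intro hy
    refine ⟨L.symm (y - s), ?_, by simp⟩
    have : L.symm (y - s) 2 = ⟪EuclideanSpace.single 2 1, L.symm (y - s)⟫_ℝ := by
      simp [EuclideanSpace.inner_single_left]
    rw [this, ← LinearIsometryEquiv.inner_map_map L, LinearIsometryEquiv.apply_symm_apply]
    exact hy

/-! ## The cover clause -/

/-- **LAYER-PLANE COVER**: every piece's layer-plane facets are a.e. covered by the closures of other pieces.
For piece `j` in `laySlab L s (slabOf j)`, the `facetArea` of `closure(P_j) ∩ (bottom ∪ top layer plane)`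
minus all other pieces' closures is zero in the stacking-normal direction `L e₃`.

WHY TRUE with a common level: all pieces come from {tent > t} for the SAME level t; on a shared layer plane,
adjacent pieces have the same boundary {tent = t} ∩ layerPlane, so they cover each other. -/
def LayerPlaneCover (L : E3 ≃ₗᵢ[ℝ] E3) (s : E3) (J : ℕ) (H : Fin J → Finset (E3 × ℝ))
    (slabOf : Fin J → ℤ) : Prop :=
  ∀ j : Fin J,
    facetArea ((closure (polytope (H j)) ∩
        (layerPlane L s (slabOf j) ∪ layerPlane L s (slabOf j + 1))) \
        ⋃ j' : {j' : Fin J // j' ≠ j}, closure (polytope (H j')))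
      (L (EuclideanSpace.single 2 1)) = 0

/-! ## The strengthened certificate -/

/-- **FREE CERTIFICATE ON A BARLOW GRAIN WITH LAYER-PLANE COVER** — `BarlowFreeCertificate` with the additional
`LayerPlaneCover` clause (achieved by using ONE COMMON LEVEL `t` across all bilayers of the grain). The difference
from `BarlowFreeCertificate` is that `slabOf` is made explicit and the cover clause is added.

WHY NEEDED: without the cover clause, the certificate solid G has horizontal fins on layer planes (where different
bilayers use different levels), and these fins are not accounted for in the perimeter bound. With a common level,
adjacent slabs' pieces share boundaries on their common layer plane, so there are no unpriced fins.

PROOF ROUTE: sum the cost functions F_i over all occupied bilayers, union the finite bad sets, pick ONE global t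
by `exists_mem_Ioo_le_of_lintegral_le`, instantiate pieces at that t for all bilayers. -/
def BarlowFreeCertificateCover : Prop :=
  ∀ σ : ℤ → ℤ, IsHaggSeq σ → ∀ (L : E3 ≃ₗᵢ[ℝ] E3) (s : E3) (A : ℤ → (E3 ≃ₗᵢ[ℝ] E3)),
    (∀ i, ∃ u : E3, bilayer L s σ i ⊆ (fun r => A i r + u) '' fccRef) →
    ∀ X : Finset E3, (↑X : Set E3) ⊆ stacking L s σ → ∀ U : Set E3, IsOpen U →
    ∃ G : Set E3, HasFinitePerimeter G ∧ volume G < ⊤ ∧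
      G ⊆ (⋃ a ∈ X, Metric.closedBall a (Real.sqrt 2)) ∧
      (∃ (J : ℕ) (H : Fin J → Finset (E3 × ℝ)) (slabOf : Fin J → ℤ),
        (∀ j, Bornology.IsBounded (polytope (H j))) ∧
        (∀ j, ∀ p ∈ H j, ‖p.1‖ = 1) ∧
        (∀ j, ∀ p ∈ H j, ∀ p' ∈ H j, p ≠ p' →
          {x : E3 | ⟪p.1, x⟫_ℝ = p.2} ≠ {x | ⟪p'.1, x⟫_ℝ = p'.2}) ∧
        (∀ j j', j ≠ j' → Disjoint (polytope (H j)) (polytope (H j'))) ∧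
        (∀ j, polytope (H j) ⊆ laySlab L s (slabOf j)) ∧
        G = ⋃ j, polytope (H j) ∧
        LayerPlaneCover L s J H slabOf) ∧
      volume ({y : E3 | ∀ b ∈ stacking L s σ, dist y b ≤ Real.sqrt 2 → b ∈ X} \ G) = 0 ∧
      2 * (∑' i : ℤ, perKIn (wulffOf (A i)) G (U ∩ laySlab L s i)) ≤
        (brokenNearIn (stacking L s σ) X U : ℝ≥0∞)

end Summit.Ventures.Crystal3D.Cruxes.TextureLiminf.TexShadow

end
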